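import Summits.QuantumFields.BalabanUV.Beta.WilsonWardSocketFit
import Summits.QuantumFields.BalabanUV.Beta.WardLocusQuarticTable

/-!
# `BalabanUV.Beta.WilsonWardSocketFitTable` — binder row D1, (L4) W-side of hW, sequel to an3's `WilsonWardSocketFit` (ONE-T, referee #12 I-d1ref12-1):
# (i) at the one table `T_W := (8N²)⁻¹ • wsym22 N` the hW level-0 Wilson lock, read in the wall shape, is EQUIVALENT to the pin `cE₂ = Lc^{2(d+1)}`;
# (ii) the level-0 TABLE LAWS `hS₂` / `hS₂''` of the W-literal's field table `T2RecAt 0` at `T := T_W` follow from the BORDER letter alone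
# (β sub-cell, D1 formalisation swarm, unit `b2b-balaban-beta-d1-formalise-leaf-05`, gen 6; INTENT «D1-hW-WIL-TW» / an3-g32 RE-SCOPE (b), journal 2026-08-20)

NOT IN PRINT; OUR BOOKKEEPING.  HONEST FRAMING (cell charter, verbatim): «discharging `BetaPertH` makes Bałaban's UV stability UNCONDITIONAL — a real
constructive-QFT result; it is NOT the continuum limit and NOT the Clay problem.»  HONEST DEPENDENCY (verbatim): «continuum YM on T⁴ ⇐ BetaPertH ∧ nine spine
estimates (0/9 proved); BetaPertH ⇐ (D1) ∧ (D4) ∧ CAP+tail; G-an2-4 gates asym, D1 and NE2/3/4.»  [folklore] wiring over tree theorems BY NAME (an3-g32's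
`WilsonWardSocketFit.hWil_wilson_TW` / `hWil''_wilson_TW`, leaf-06-g3's `WardLocusQuarticTable.tableLaw_T2RecAt_zero` / `''`, `KernelWardLevels.stepScale_zero`); no
statement of Bałaban's papers, no `[cite:]`, no `def`, no `def … : Prop`; instantiates NO binder of the β-function wall.  NOT hW, NOT D1, NOT `BetaPertH`, NOT
continuum, NOT Clay.

WHY.  `WilsonWardSocketFit` supplies the hW Wilson binders `hWil` / `hWil''` at the hR-fixed table `T_W` under the pin `cE₂ = Lc^{2(d+1)}` (its `lock_TW`: pin ⇒ lock).
Here (§1) the converse is recorded — in the wall shape (`c = Lc^{d+1}`, generator scale `½`, `cH′ = (stepScale d Lc 0·Lc^{d+1})⁻¹`) the `T_W` lock `cH′·cE₂ = 2·c·ξ`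
holds IFF `cE₂ = Lc^{2(d+1)}`: at ONE table the level-0 hW Wilson lock, hR's (W-L-2) (`SecondOrderLockPin.lock2_iff`, `Lc⁸` at `d = 3`) and the pin of
`WardLocusQuarticTable.lock_succ_of_pin` (every level `j+1`) are ONE condition; and (§2) leaf-06-g3's level-0 assembly `tableLaw_T2RecAt_zero` / `''` is fed with
the supplied binders, so the `hS₂` / `hS₂''` laws of `T2RecAt 0` at `T := T_W` — the level-0 inputs of `WardLocusRecursiveStep.divW_WrecAt_of_tableLaws` — need
only the BORDER letter (an1's lane), the pin and the colour data.
* §1 `lock_zero_iff_pin_TW`.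
* §2 `tableLaw_T2RecAt_zero_TW` / `tableLaw_T2RecAt_zero_TW''`.
Provenance: D1 formalisation swarm, leaf prover 05 (gen 6), 2026-08-20; no existing file touched.
-/

noncomputable section

namespace Summit.QuantumFields.BalabanUV.Beta.WilsonWardSocketFitTable

open Finset
open scoped BigOperators
open Literature.MathematicalPhysics.QuantumFieldTheory.Balaban1983to89
open Literature.MathematicalPhysics.QuantumFieldTheory.Balaban1983to89.Beta
open ColourTrace (Complete TrOrthonormal)
open WilsonVertex2Sym (wsym22)
open WilsonBiStencil (wilsonW₂)
open StepJetData (wilsonA)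
open ExpKernelCalculus (MKer comp)
open OneStepResolventKernel (Fib)
open KernelWard (divV)
open AffineAveraging (box toSite)
open AveragingHessianKernelsRooted (vhSAt)
open Summit.QuantumFields.BalabanUV.Beta.BorderedHessian (diagK stepScale)
open Summit.QuantumFields.BalabanUV.Beta.AveragingWardRootedStencils (legInd)
open Summit.QuantumFields.BalabanUV.Beta.KernelWardLevels (stepScale_zero)
open Summit.QuantumFields.BalabanUV.Beta.WilsonWardSocketFit (hWil_wilson_TW hWil''_wilson_TW)
open Summit.QuantumFields.BalabanUV.Beta.SpineRooted (SpureRecAt T2RecAt)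
open Summit.QuantumFields.BalabanUV.Beta.WardLocusQuarticTable (tableLaw_T2RecAt_zero tableLaw_T2RecAt_zero'')

variable {d N : ℕ}

/-! ## §1 At `T_W` the level-0 hW Wilson lock, in the wall shape, IS the pin -/

/-- [folklore] **ONE PIN, ONE TABLE**: in the hW wall shape (first-order Wilson coefficient `c = Lc^{d+1}`, generator scale `ξ = ½`, ℋ-column constant
`cH′ = (stepScale d Lc 0·Lc^{d+1})⁻¹`) the `T_W` lock `cH′·cE₂ = 2·c·ξ` (the form under which `WilsonBiStencilWardSocket.hS₂_wilson` transfers to the table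
`(8N²)⁻¹ • wsym22 N` with the sector coefficient `cE₂` inside) holds IFF `cE₂ = Lc^{2(d+1)}` — hR's (W-L-2) (`SecondOrderLockPin.lock2_iff`, `Lc⁸` at `d = 3`)
and the pin of `WardLocusQuarticTable.lock_succ_of_pin` at every level `j+1`; `WilsonWardSocketFit.lock_TW` is the direction pin ⇒ lock in its own normal form. -/
theorem lock_zero_iff_pin_TW {Lc : ℕ} (hLc : 1 ≤ Lc) (cE₂ : ℝ) :
    (stepScale d Lc 0 * (Lc : ℝ) ^ (d + 1))⁻¹ * cE₂ = 2 * (Lc : ℝ) ^ (d + 1) * ((1 : ℝ) / 2) ↔ cE₂ = (Lc : ℝ) ^ (2 * (d + 1)) := by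
  have hL : (Lc : ℝ) ≠ 0 := Nat.cast_ne_zero.2 (by omega)
  have hLp : (Lc : ℝ) ^ (d + 1) ≠ 0 := pow_ne_zero _ hL
  rw [stepScale_zero, one_mul, pow_mul', sq]
  constructor
  · intro h
    have h' : cE₂ = (Lc : ℝ) ^ (d + 1) * (((Lc : ℝ) ^ (d + 1))⁻¹ * cE₂) := by
      rw [← mul_assoc, mul_inv_cancel₀ hLp, one_mul]
    rw [h', h]; ring
  · intro h
    rw [h, ← mul_assoc, inv_mul_cancel₀ hLp]; ring

/-! ## §2 The level-0 table laws of `T2RecAt 0` at `T_W` from the border letter alone -/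

section Wall

variable {Lc : ℕ} [NeZero Lc] {C : Type*} [Fintype C] [DecidableEq C] {τ : C → Matrix (Fin N) (Fin N) ℂ}

/-- [folklore] **THE `hS₂` LAW OF THE LEVEL-0 FIELD TABLE `T2RecAt 0` AT `T := T_W = (8N²)⁻¹ • wsym22 N`, FIRST SLOT** (in-block root `ρ = toSite r`, hW pin
`(cE, cVH) = (Lc^{d+1}, −Lc^{d+1}·½·Lc^{d+1})`, second-order pin `cE₂ = Lc^{2(d+1)}`, colour data `(τ, hτ, ho, hN, c)`): the Wilson letter is SUPPLIED by
`WilsonWardSocketFit.hWil_wilson_TW` (remainder `0`); the BORDER letter `hBord` of `cB • vh₂S` against `cVH • vhSAt ρ` (remainder `RB`, an1's lane) is the ONLY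
letter hypothesis — `WardLocusQuarticTable.tableLaw_T2RecAt_zero` BY NAME, the `0 +` of the Wilson remainder removed. -/
theorem tableLaw_T2RecAt_zero_TW (hτ : Complete τ) (ho : TrOrthonormal τ) (hN : N ≠ 0) (c : C) (r : Fin (d + 1) → ℕ)
    (cΛ cB : ℝ) {cE₂ : ℝ} (hcE₂ : cE₂ = (Lc : ℝ) ^ (2 * (d + 1)))
    (vh₂S mixFF : Fin (d + 1) → (Fin (d + 1) → ℤ) → Fin (d + 1) → (Fin (d + 1) → ℤ) → MKer (d + 1) (Fib d))
    {RB : (Fin (d + 1) → ℤ) → Fin (d + 1) → (Fin (d + 1) → ℤ) → MKer (d + 1) (Fib d)}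
    (hBord : ∀ (Y : Fin (d + 1) → ℤ) (κ' : Fin (d + 1)) (u' : Fin (d + 1) → ℤ),
      (stepScale d Lc 0 * (Lc : ℝ) ^ (d + 1))⁻¹ • ∑ v ∈ box (d + 1) Lc, divV (fun κ u => cB • vh₂S κ u κ' u') ((Lc : ℤ) • Y + toSite v) =
        comp ((-((Lc : ℝ) ^ (d + 1) * (1 / 2) * (Lc : ℝ) ^ (d + 1))) • vhSAt (toSite r) d Lc rfl κ' u')
            (diagK (((1 : ℝ) / 2) • ∑ v ∈ box (d + 1) Lc, legInd (toSite r) ((Lc : ℤ) • Y + toSite v)))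
          - comp (diagK (((1 : ℝ) / 2) • ∑ v ∈ box (d + 1) Lc, legInd (toSite r) ((Lc : ℤ) • Y + toSite v)))
            ((-((Lc : ℝ) ^ (d + 1) * (1 / 2) * (Lc : ℝ) ^ (d + 1))) • vhSAt (toSite r) d Lc rfl κ' u')
          + RB Y κ' u')
    (Y : Fin (d + 1) → ℤ) (κ' : Fin (d + 1)) (u' : Fin (d + 1) → ℤ) :
    (stepScale d Lc 0 * (Lc : ℝ) ^ (d + 1))⁻¹ • ∑ v ∈ box (d + 1) Lc, divV (fun κ u =>
        T2RecAt d Lc (toSite r) ((Lc : ℝ) ^ (d + 1)) (-((Lc : ℝ) ^ (d + 1) * (1 / 2) * (Lc : ℝ) ^ (d + 1))) cΛ cE₂ cB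
          ((8 * (N : ℝ) ^ 2)⁻¹ • wsym22 N) vh₂S mixFF 0 κ u κ' u')
        ((Lc : ℤ) • Y + toSite v) =
      comp (SpureRecAt d Lc (toSite r) ((Lc : ℝ) ^ (d + 1)) (-((Lc : ℝ) ^ (d + 1) * (1 / 2) * (Lc : ℝ) ^ (d + 1))) cΛ 0 κ' u')
          (diagK (((1 : ℝ) / 2) • ∑ v ∈ box (d + 1) Lc, legInd (toSite r) ((Lc : ℤ) • Y + toSite v)))
        - comp (diagK (((1 : ℝ) / 2) • ∑ v ∈ box (d + 1) Lc, legInd (toSite r) ((Lc : ℤ) • Y + toSite v)))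
          (SpureRecAt d Lc (toSite r) ((Lc : ℝ) ^ (d + 1)) (-((Lc : ℝ) ^ (d + 1) * (1 / 2) * (Lc : ℝ) ^ (d + 1))) cΛ 0 κ' u')
        + RB Y κ' u' := by
  have h := tableLaw_T2RecAt_zero (Lc := Lc) (r := r) cΛ cE₂ cB ((8 * (N : ℝ) ^ 2)⁻¹ • wsym22 N) vh₂S mixFF
    (hWil_wilson_TW hτ ho hN c Lc r hcE₂) hBord Y κ' u'
  simpa only [Pi.zero_apply, zero_add] using h

/-- [folklore] **THE `hS₂''` LAW OF `T2RecAt 0` AT `T := T_W`, SECOND SLOT**, from the second-slot border letter `hBord''` alone (`WilsonWardSocketFit.hWil''_wilson_TW`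
+ `WardLocusQuarticTable.tableLaw_T2RecAt_zero''`). -/
theorem tableLaw_T2RecAt_zero_TW'' (hτ : Complete τ) (ho : TrOrthonormal τ) (hN : N ≠ 0) (c : C) (r : Fin (d + 1) → ℕ)
    (cΛ cB : ℝ) {cE₂ : ℝ} (hcE₂ : cE₂ = (Lc : ℝ) ^ (2 * (d + 1)))
    (vh₂S mixFF : Fin (d + 1) → (Fin (d + 1) → ℤ) → Fin (d + 1) → (Fin (d + 1) → ℤ) → MKer (d + 1) (Fib d))
    {RB'' : (Fin (d + 1) → ℤ) → Fin (d + 1) → (Fin (d + 1) → ℤ) → MKer (d + 1) (Fib d)}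
    (hBord'' : ∀ (Y : Fin (d + 1) → ℤ) (κ : Fin (d + 1)) (u : Fin (d + 1) → ℤ),
      (stepScale d Lc 0 * (Lc : ℝ) ^ (d + 1))⁻¹ • ∑ v ∈ box (d + 1) Lc, divV (fun κ' u' => cB • vh₂S κ u κ' u') ((Lc : ℤ) • Y + toSite v) =
        comp ((-((Lc : ℝ) ^ (d + 1) * (1 / 2) * (Lc : ℝ) ^ (d + 1))) • vhSAt (toSite r) d Lc rfl κ u)
            (diagK (((1 : ℝ) / 2) • ∑ v ∈ box (d + 1) Lc, legInd (toSite r) ((Lc : ℤ) • Y + toSite v)))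
          - comp (diagK (((1 : ℝ) / 2) • ∑ v ∈ box (d + 1) Lc, legInd (toSite r) ((Lc : ℤ) • Y + toSite v)))
            ((-((Lc : ℝ) ^ (d + 1) * (1 / 2) * (Lc : ℝ) ^ (d + 1))) • vhSAt (toSite r) d Lc rfl κ u)
          + RB'' Y κ u)
    (Y : Fin (d + 1) → ℤ) (κ : Fin (d + 1)) (u : Fin (d + 1) → ℤ) :
    (stepScale d Lc 0 * (Lc : ℝ) ^ (d + 1))⁻¹ • ∑ v ∈ box (d + 1) Lc, divV
        (T2RecAt d Lc (toSite r) ((Lc : ℝ) ^ (d + 1)) (-((Lc : ℝ) ^ (d + 1) * (1 / 2) * (Lc : ℝ) ^ (d + 1))) cΛ cE₂ cB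
          ((8 * (N : ℝ) ^ 2)⁻¹ • wsym22 N) vh₂S mixFF 0 κ u)
        ((Lc : ℤ) • Y + toSite v) =
      comp (SpureRecAt d Lc (toSite r) ((Lc : ℝ) ^ (d + 1)) (-((Lc : ℝ) ^ (d + 1) * (1 / 2) * (Lc : ℝ) ^ (d + 1))) cΛ 0 κ u)
          (diagK (((1 : ℝ) / 2) • ∑ v ∈ box (d + 1) Lc, legInd (toSite r) ((Lc : ℤ) • Y + toSite v)))
        - comp (diagK (((1 : ℝ) / 2) • ∑ v ∈ box (d + 1) Lc, legInd (toSite r) ((Lc : ℤ) • Y + toSite v)))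
          (SpureRecAt d Lc (toSite r) ((Lc : ℝ) ^ (d + 1)) (-((Lc : ℝ) ^ (d + 1) * (1 / 2) * (Lc : ℝ) ^ (d + 1))) cΛ 0 κ u)
        + RB'' Y κ u := by
  have h := tableLaw_T2RecAt_zero'' (Lc := Lc) (r := r) cΛ cE₂ cB ((8 * (N : ℝ) ^ 2)⁻¹ • wsym22 N) vh₂S mixFF
    (hWil''_wilson_TW hτ ho hN c Lc r hcE₂) hBord'' Y κ u
  simpa only [Pi.zero_apply, zero_add] using h

end Wall

end Summit.QuantumFields.BalabanUV.Beta.WilsonWardSocketFitTable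

end
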